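import Summits.NavierStokesRegularity.FunctionalMining.NoGo.PalinstrophyStrainTransport
import HarnessLib

/-!
# Palinstrophy production in strain currency, III: the K1-Q0(𝒫) ladder constant `κ_S = (2/3)^{4/3} κ_A`

Search for candidate a priori estimates; no regularity claim. Part 3/3 of the no-go seat's staged
`NoGo/PalinstrophyStrainTransport.STAGING.lean` v2.1 (split by the prove seat for the 400-line cap, text verbatim).
With L1 at `√6` (part 2, `palinstrophyProductionSupBoundWith_sqrt_six`) and parametric copies of the tree's L4 /
assembly (`ladderConstOf a`, `ladderRealIneq_param`, `palinstrophySaturatingLaw_of_productionConst`):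
`palinstrophySaturatingLaw_strain : palinstrophyLadderConstStrain ≤ κ → PalinstrophySaturatingLaw κ`,
`palinstrophyLadderConstStrain_eq : κ_S = (2/3)^(4/3) · palinstrophyLadderConst`, `palinstrophyLadderConstStrain_lt`.
[ours — internal, unreviewed; see the module docstring of part 2 for the full account]
-/

noncomputable section

open MeasureTheory Set Finset Real
open scoped InnerProductSpace RealInnerProductSpace

namespace Summit.NavierStokesRegularity.FunctionalMining

open Literature.Analysis.FunctionSpaces Literature.Analysis.FluidPDE

variable {d : Type*} [Fintype d] [DecidableEq d]

/-! ## The K1-Q0(𝒫) ladder constant in `√6` currency: `κ_A ↦ (2/3)^{4/3} κ_A`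

The tree's palinstrophy ladder law (`PalinstrophyLadderProofs.palinstrophyLadderLaw`) feeds L1 with the
Doering–Gibbon constant `3`; `palinstrophyProduction_le_sqrt_six_of_gradSup` above is L1 with `√6`. The
real inequality L4 and the assembly are re-run here with the production constant as a PARAMETER `C`
(`a = 2C√2/π`, `κ(a) = (3/256)(5/2)^{5/3} a^{8/3}`), verbatim copies of the tree proofs
`ladderConst_identity`, `ladderRealIneq_holds`, `palinstrophyLadderLaw_of_bounds` with `3 ↦ C`; at
`C = √6` the law holds for every `κ ≥ κ(2√6·√2/π) = (2/3)^{4/3} κ_A` (`≈ 0.4447`, vs `κ_A ≈ 0.7635`).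
Search for candidate a priori estimates; no regularity claim. -/

/-- The ladder constant as a function of the production prefactor `a`:
`κ(a) := (3/256)(5/2)^{5/3} a^{8/3}` (`κ(6√2/π) = palinstrophyLadderConst`). [folklore] -/
def ladderConstOf (a : ℝ) : ℝ :=
  3 / 256 * (5 / 2 : ℝ) ^ (5 / 3 : ℝ) * a ^ (8 / 3 : ℝ)

/-- `κ(a) ≥ 0` for `a ≥ 0`. [folklore] -/
theorem ladderConstOf_nonneg {a : ℝ} (ha : 0 ≤ a) : 0 ≤ ladderConstOf a := by
  unfold ladderConstOf; positivity

/-- `κ(6√2/π) = κ_A`. [folklore] -/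
theorem ladderConstOf_six_sqrt_two_div_pi :
    ladderConstOf (6 * (Real.sqrt 2 / Real.pi)) = palinstrophyLadderConst := rfl

/-- Parametric constant identity: `(16/5)^{5/8} · ((8/3) κ(a))^{3/8} = a` for `a ≥ 0` (eighth powers;
copy of the tree's `ladderConst_identity` with `a` free). [folklore] -/
theorem ladderConstOf_identity {a : ℝ} (ha : 0 ≤ a) :
    (16 / 5 : ℝ) ^ (5 / 8 : ℝ) * (8 / 3 * ladderConstOf a) ^ (3 / 8 : ℝ) = a := by
  have hκ : ladderConstOf a = 3 / 256 * (5 / 2 : ℝ) ^ (5 / 3 : ℝ) * a ^ (8 / 3 : ℝ) := rfl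
  have hκ0 : 0 ≤ 8 / 3 * ladderConstOf a := by rw [hκ]; positivity
  have hL0 : 0 ≤ (16 / 5 : ℝ) ^ (5 / 8 : ℝ) * (8 / 3 * ladderConstOf a) ^ (3 / 8 : ℝ) := by
    positivity
  have h1 : ((16 / 5 : ℝ) ^ (5 / 8 : ℝ)) ^ 8 = (16 / 5 : ℝ) ^ 5 := by
    rw [rpow_rpow_natCast (by norm_num) (5 / 8) 8,
      show (5 / 8 : ℝ) * (8 : ℕ) = ((5 : ℕ) : ℝ) by norm_num, Real.rpow_natCast]
  have h2 : ((8 / 3 * ladderConstOf a) ^ (3 / 8 : ℝ)) ^ 8 = (8 / 3 * ladderConstOf a) ^ 3 := by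
    rw [rpow_rpow_natCast hκ0 (3 / 8) 8,
      show (3 / 8 : ℝ) * (8 : ℕ) = ((3 : ℕ) : ℝ) by norm_num, Real.rpow_natCast]
  have h53 : ((5 / 2 : ℝ) ^ (5 / 3 : ℝ)) ^ 3 = (5 / 2 : ℝ) ^ 5 := by
    rw [rpow_rpow_natCast (by norm_num) (5 / 3) 3,
      show (5 / 3 : ℝ) * (3 : ℕ) = ((5 : ℕ) : ℝ) by norm_num, Real.rpow_natCast]
  have h83 : (a ^ (8 / 3 : ℝ)) ^ 3 = a ^ 8 := by
    rw [rpow_rpow_natCast ha (8 / 3) 3,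
      show (8 / 3 : ℝ) * (3 : ℕ) = ((8 : ℕ) : ℝ) by norm_num, Real.rpow_natCast]
  rw [← pow_left_inj₀ hL0 ha (by norm_num : (8 : ℕ) ≠ 0), mul_pow, h1, h2, hκ]
  have : (8 / 3 * (3 / 256 * (5 / 2 : ℝ) ^ (5 / 3 : ℝ) * a ^ (8 / 3 : ℝ))) ^ 3 =
      (8 / 3 * (3 / 256)) ^ 3 * ((5 / 2 : ℝ) ^ (5 / 3 : ℝ)) ^ 3 * (a ^ (8 / 3 : ℝ)) ^ 3 := by ring
  rw [this, h53, h83]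
  norm_num
  ring

/-- **L4 with a free prefactor**: for `P, D, E ≥ 0`, `ν > 0`, `P² ≤ E·D` and `a ≥ 0`,
`a P^{5/4} D^{1/4} − 2νD ≤ κ(a) ν^{-5/3} E P^{4/3}` (weighted AM–GM, exactly as the tree's
`ladderRealIneq_holds`). [folklore] -/
theorem ladderRealIneq_param {a : ℝ} (ha : 0 ≤ a) (P D E ν : ℝ) (hP : 0 ≤ P) (hD : 0 ≤ D)
    (hE : 0 ≤ E) (hν : 0 < ν) (hPED : P ^ 2 ≤ E * D) :
    a * P ^ (5 / 4 : ℝ) * D ^ (1 / 4 : ℝ) - 2 * ν * D ≤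
      ladderConstOf a * ν ^ (-(5 / 3 : ℝ)) * E * P ^ (4 / 3 : ℝ) := by
  set κ := ladderConstOf a with hκdef
  have hκ0 : 0 ≤ κ := ladderConstOf_nonneg ha
  have hνr : ∀ r : ℝ, 0 < ν ^ r := fun r => Real.rpow_pos_of_pos hν r
  rcases hD.eq_or_lt with hD0 | hDpos
  · rw [← hD0, Real.zero_rpow (by norm_num), mul_zero, mul_zero, sub_zero]
    have : 0 ≤ κ * ν ^ (-(5 / 3 : ℝ)) * E * P ^ (4 / 3 : ℝ) := by
      have := hνr (-(5 / 3)); positivity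
    linarith
  set u : ℝ := 16 / 5 * ν * D ^ 2 with hu
  set w : ℝ := 8 / 3 * κ * (ν ^ (-(5 / 3 : ℝ)) * P ^ (10 / 3 : ℝ)) with hw
  have hu0 : 0 ≤ u := by positivity
  have hw0 : 0 ≤ w := by have := hνr (-(5 / 3)); positivity
  have hAM := Real.geom_mean_le_arith_mean2_weighted (by norm_num : (0 : ℝ) ≤ 5 / 8)
    (by norm_num : (0 : ℝ) ≤ 3 / 8) hu0 hw0 (by norm_num : (5 / 8 : ℝ) + 3 / 8 = 1)
  have hu58 : u ^ (5 / 8 : ℝ) = (16 / 5 : ℝ) ^ (5 / 8 : ℝ) * ν ^ (5 / 8 : ℝ) * D ^ (5 / 4 : ℝ) := by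
    rw [hu, Real.mul_rpow (by positivity) (by positivity), Real.mul_rpow (by norm_num) hν.le,
      show D ^ 2 = D ^ (2 : ℝ) by norm_cast, ← Real.rpow_mul hD]
    norm_num
  have hw38 : w ^ (3 / 8 : ℝ) =
      (8 / 3 * κ) ^ (3 / 8 : ℝ) * ν ^ (-(5 / 8 : ℝ)) * P ^ (5 / 4 : ℝ) := by
    rw [hw, Real.mul_rpow (by positivity) (by have := hνr (-(5 / 3)); positivity),
      Real.mul_rpow (hνr _).le (Real.rpow_nonneg hP _), ← Real.rpow_mul hν.le, ← Real.rpow_mul hP]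
    norm_num
    ring
  have hprod : u ^ (5 / 8 : ℝ) * w ^ (3 / 8 : ℝ) = a * P ^ (5 / 4 : ℝ) * D ^ (5 / 4 : ℝ) := by
    rw [hu58, hw38]
    have hνν : ν ^ (5 / 8 : ℝ) * ν ^ (-(5 / 8 : ℝ)) = 1 := by
      rw [← Real.rpow_add hν]; norm_num
    have hc := ladderConstOf_identity ha
    rw [← hκdef] at hc
    calc (16 / 5 : ℝ) ^ (5 / 8 : ℝ) * ν ^ (5 / 8 : ℝ) * D ^ (5 / 4 : ℝ) *
          ((8 / 3 * κ) ^ (3 / 8 : ℝ) * ν ^ (-(5 / 8 : ℝ)) * P ^ (5 / 4 : ℝ))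
        = ((16 / 5 : ℝ) ^ (5 / 8 : ℝ) * (8 / 3 * κ) ^ (3 / 8 : ℝ)) *
            (ν ^ (5 / 8 : ℝ) * ν ^ (-(5 / 8 : ℝ))) * (P ^ (5 / 4 : ℝ) * D ^ (5 / 4 : ℝ)) := by ring
      _ = a * P ^ (5 / 4 : ℝ) * D ^ (5 / 4 : ℝ) := by rw [hc, hνν]; ring
  have hrhs : 5 / 8 * u + 3 / 8 * w = 2 * ν * D ^ 2 + κ * ν ^ (-(5 / 3 : ℝ)) * P ^ (10 / 3 : ℝ) := by
    rw [hu, hw]; ring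
  have key : a * P ^ (5 / 4 : ℝ) * D ^ (5 / 4 : ℝ) ≤
      2 * ν * D ^ 2 + κ * ν ^ (-(5 / 3 : ℝ)) * P ^ (10 / 3 : ℝ) := by
    rw [← hprod, ← hrhs]; exact hAM
  have hD54 : D ^ (5 / 4 : ℝ) = D * D ^ (1 / 4 : ℝ) := by
    rw [show (5 / 4 : ℝ) = 1 + 1 / 4 by norm_num, Real.rpow_add hDpos, Real.rpow_one]
  have hP103 : P ^ (10 / 3 : ℝ) = P ^ 2 * P ^ (4 / 3 : ℝ) := by
    rw [show (10 / 3 : ℝ) = 2 + 4 / 3 by norm_num, Real.rpow_add' hP (by norm_num),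
      show P ^ (2 : ℝ) = P ^ 2 by norm_cast]
  have hP43 : 0 ≤ P ^ (4 / 3 : ℝ) := Real.rpow_nonneg hP _
  have h1 : κ * ν ^ (-(5 / 3 : ℝ)) * P ^ (10 / 3 : ℝ) ≤
      D * (κ * ν ^ (-(5 / 3 : ℝ)) * E * P ^ (4 / 3 : ℝ)) := by
    rw [hP103]
    have hk : 0 ≤ κ * ν ^ (-(5 / 3 : ℝ)) := by have := hνr (-(5 / 3)); positivity
    have : κ * ν ^ (-(5 / 3 : ℝ)) * (P ^ 2 * P ^ (4 / 3 : ℝ)) ≤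
        κ * ν ^ (-(5 / 3 : ℝ)) * (E * D * P ^ (4 / 3 : ℝ)) :=
      mul_le_mul_of_nonneg_left (mul_le_mul_of_nonneg_right hPED hP43) hk
    linarith [this]
  have h2 : D * (a * P ^ (5 / 4 : ℝ) * D ^ (1 / 4 : ℝ) - 2 * ν * D) ≤
      D * (κ * ν ^ (-(5 / 3 : ℝ)) * E * P ^ (4 / 3 : ℝ)) := by
    have : D * (a * P ^ (5 / 4 : ℝ) * D ^ (1 / 4 : ℝ) - 2 * ν * D) =
        a * P ^ (5 / 4 : ℝ) * D ^ (5 / 4 : ℝ) - 2 * ν * D ^ 2 := by rw [hD54]; ring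
    rw [this]
    linarith
  exact le_of_mul_le_mul_left h2 hDpos

/-- **L1 with a free constant**: `N(v) ≤ C·M·𝒫(v)` whenever `Σᵢ‖∂ᵢv(x)‖² ≤ M²` pointwise (smooth
divergence-free `v` on `T³`). The tree's `PalinstrophyProductionSupBound` is the case `C = 3`;
`palinstrophyProduction_le_sqrt_six_of_gradSup` gives `C = √6`. Search for candidate a priori estimates;
no regularity claim — nothing is asserted. -/
def PalinstrophyProductionSupBoundWith (C : ℝ) : Prop :=
  Fintype.card d = 3 → ∀ v : UnitAddTorus d → EuclideanSpace ℝ d, Torus.IsSmooth v →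
    Torus.IsDivFree v → ∀ M : ℝ, 0 ≤ M → (∀ x, ∑ i, ‖Torus.partialDeriv i v x‖ ^ 2 ≤ M ^ 2) →
      palinstrophyProduction v ≤ C * M * torusPalinstrophy v

/-- The tree's L1 is the case `C = 3`. [folklore] -/
theorem palinstrophyProductionSupBoundWith_three_iff :
    PalinstrophyProductionSupBoundWith (d := d) 3 ↔ PalinstrophyProductionSupBound (d := d) := Iff.rfl

/-- L1 holds with `C = √6` (this file). [folklore] -/
theorem palinstrophyProductionSupBoundWith_sqrt_six :
    PalinstrophyProductionSupBoundWith (d := d) (Real.sqrt 6) :=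
  fun hd _v hv hdiv _M hM hgrad => palinstrophyProduction_le_sqrt_six_of_gradSup hd hv hdiv hM hgrad

/-- **Parametric assembly**: L1 at constant `C ≥ 0`, Agmon (L2) and interpolation (L3) give the
palinstrophy saturating law `d𝒫/dt ≤ κ ν^{-5/3}(2ℰ)𝒫^{4/3}` for every `κ ≥ κ(2C√2/π)` (copy of the
tree's `palinstrophyLadderLaw_of_bounds` with `3 ↦ C` and L4 supplied by `ladderRealIneq_param`).
Search for candidate a priori estimates; no regularity claim. [folklore] -/
theorem palinstrophySaturatingLaw_of_productionConst {C : ℝ} (hC : 0 ≤ C)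
    (h1 : PalinstrophyProductionSupBoundWith (d := d) C) (h2 : GradientAgmonBound (d := d))
    (h3 : PalinstrophyInterpolation (d := d)) {κ : ℝ}
    (hκ : ladderConstOf (2 * C * (Real.sqrt 2 / Real.pi)) ≤ κ) :
    PalinstrophySaturatingLaw (d := d) κ := by
  refine PalinstrophySaturatingLaw.mono ?_ hκ
  intro hd ν hν a b hab u p hsol hmean t ht
  have hder := torusPalinstrophy_hasDerivWithinAt hsol hab ht
  refine ⟨hder.differentiableWithinAt, ?_⟩
  rw [hder.derivWithin (uniqueDiffOn_Icc hab t ht)]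
  have hsm : Torus.IsSmooth (u t) := hsol.smooth_velocity.isSmooth_slice ht
  have hdf : Torus.IsDivFree (u t) := hsol.divFree t ht
  set P := torusPalinstrophy (u t) with hP
  set D := palinstrophyDissipation (u t) with hD
  set E := 2 * torusEnstrophy (u t) with hE
  have hP0 : 0 ≤ P := torusPalinstrophy_nonneg _
  have hD0 : 0 ≤ D := palinstrophyDissipation_nonneg _
  have hE0 : 0 ≤ E := mul_nonneg (by norm_num) (torusEnstrophy_nonneg _)
  set M2 := 2 / Real.pi ^ 2 * Real.sqrt P * Real.sqrt D with hM2
  have hM2_nonneg : 0 ≤ M2 := by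
    have : 0 ≤ 2 / Real.pi ^ 2 := by positivity
    exact mul_nonneg (mul_nonneg this (Real.sqrt_nonneg _)) (Real.sqrt_nonneg _)
  set M := Real.sqrt M2 with hM
  have hM0 : 0 ≤ M := Real.sqrt_nonneg _
  have hMsq : M ^ 2 = M2 := Real.sq_sqrt hM2_nonneg
  have hgrad : ∀ x, ∑ i, ‖Torus.partialDeriv i (u t) x‖ ^ 2 ≤ M ^ 2 := fun x => by
    rw [hMsq]; exact h2 hd (u t) hsm x
  have hN : palinstrophyProduction (u t) ≤ C * M * P := h1 hd (u t) hsm hdf M hM0 hgrad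
  have hMval : M = Real.sqrt 2 / Real.pi * P ^ (1 / 4 : ℝ) * D ^ (1 / 4 : ℝ) := by
    have hpi : 0 < Real.pi := Real.pi_pos
    have hsP : Real.sqrt P = P ^ (1 / 2 : ℝ) := Real.sqrt_eq_rpow P
    have hsD : Real.sqrt D = D ^ (1 / 2 : ℝ) := Real.sqrt_eq_rpow D
    have hq : ∀ y : ℝ, 0 ≤ y → Real.sqrt (y ^ (1 / 2 : ℝ)) = y ^ (1 / 4 : ℝ) := fun y hy => by
      rw [Real.sqrt_eq_rpow, ← Real.rpow_mul hy]; norm_num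
    have h2pi : Real.sqrt (2 / Real.pi ^ 2) = Real.sqrt 2 / Real.pi := by
      rw [Real.sqrt_div' _ (by positivity), Real.sqrt_sq hpi.le]
    rw [hM, hM2, hsP, hsD, Real.sqrt_mul (mul_nonneg (by positivity) (Real.rpow_nonneg hP0 _)),
      Real.sqrt_mul (by positivity), h2pi, hq P hP0, hq D hD0]
  have hCMP : C * M * P =
      C * (Real.sqrt 2 / Real.pi) * P ^ (5 / 4 : ℝ) * D ^ (1 / 4 : ℝ) := by
    rw [hMval]
    have h54 : P ^ (5 / 4 : ℝ) = P ^ (1 / 4 : ℝ) * P := by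
      rw [show (5 / 4 : ℝ) = 1 / 4 + 1 by norm_num, Real.rpow_add_one' hP0 (by norm_num)]
    rw [h54]; ring
  have hI : P ^ 2 ≤ E * D := h3 (u t) hsm
  have ha : 0 ≤ 2 * C * (Real.sqrt 2 / Real.pi) := by positivity
  have hR := ladderRealIneq_param ha P D E ν hP0 hD0 hE0 hν hI
  have hexp : (1 : ℝ) + (3 : ℝ)⁻¹ = 4 / 3 := by norm_num
  rw [hexp]
  have h2N : 2 * palinstrophyProduction (u t) ≤
      2 * C * (Real.sqrt 2 / Real.pi) * P ^ (5 / 4 : ℝ) * D ^ (1 / 4 : ℝ) := by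
    have := mul_le_mul_of_nonneg_left hN (by norm_num : (0 : ℝ) ≤ 2)
    rw [hCMP] at this
    linarith
  linarith [h2N, hR]

/-- The strain-currency ladder constant `κ_S := κ(2√6·√2/π)`. [folklore] -/
def palinstrophyLadderConstStrain : ℝ :=
  ladderConstOf (2 * Real.sqrt 6 * (Real.sqrt 2 / Real.pi))

/-- **The palinstrophy saturating law at the improved constant**: for every
`κ ≥ κ_S = κ(2√6·√2/π)`, `d𝒫/dt ≤ κ ν^{-5/3} (2ℰ) 𝒫^{4/3}` along every zero-mean classical solution of
unforced Navier–Stokes on `T³` — the tree's ladder with L1 at `√6` (this file) instead of `3`.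
Search for candidate a priori estimates; no regularity claim (an a-priori-shape statement).
[folklore] -/
theorem palinstrophySaturatingLaw_strain {κ : ℝ} (hκ : palinstrophyLadderConstStrain ≤ κ) :
    PalinstrophySaturatingLaw (d := d) κ :=
  palinstrophySaturatingLaw_of_productionConst (Real.sqrt_nonneg 6)
    palinstrophyProductionSupBoundWith_sqrt_six gradientAgmonBound_holds
    palinstrophyInterpolation_holds hκ

/-- `κ(t·a) = t^{8/3} κ(a)` for `t, a ≥ 0`. [folklore] -/
theorem ladderConstOf_mul {t a : ℝ} (ht : 0 ≤ t) (ha : 0 ≤ a) :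
    ladderConstOf (t * a) = t ^ (8 / 3 : ℝ) * ladderConstOf a := by
  unfold ladderConstOf
  rw [Real.mul_rpow ht ha]
  ring

/-- **`κ_S = (2/3)^{4/3} · κ_A`** (`2√6·√2/π = (√6/3)·(6√2/π)` and `(√6/3)^{8/3} = (2/3)^{4/3}`).
[folklore] -/
theorem palinstrophyLadderConstStrain_eq :
    palinstrophyLadderConstStrain = (2 / 3 : ℝ) ^ (4 / 3 : ℝ) * palinstrophyLadderConst := by
  have h6 : 0 ≤ Real.sqrt 6 / 3 := by positivity
  have ha : 0 ≤ 6 * (Real.sqrt 2 / Real.pi) := by positivity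
  have hmul : 2 * Real.sqrt 6 * (Real.sqrt 2 / Real.pi) =
      Real.sqrt 6 / 3 * (6 * (Real.sqrt 2 / Real.pi)) := by ring
  rw [palinstrophyLadderConstStrain, hmul, ladderConstOf_mul h6 ha,
    ladderConstOf_six_sqrt_two_div_pi]
  congr 1
  -- (√6/3)^{8/3} = ((√6/3)^2)^{4/3} = (2/3)^{4/3}
  have hsq : (Real.sqrt 6 / 3) ^ 2 = 2 / 3 := by
    rw [div_pow, Real.sq_sqrt (by norm_num)]; norm_num
  rw [← hsq, show ((Real.sqrt 6 / 3) ^ 2) = (Real.sqrt 6 / 3) ^ (2 : ℝ) by norm_cast,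
    ← Real.rpow_mul h6]
  norm_num

/-- Numeric bracket: `(2/3)^{4/3} < 0.583` (cubes: `(2/3)⁴ = 16/81 < 0.583³`), so
`κ_S < 0.583 κ_A`. [folklore] -/
theorem two_thirds_rpow_four_thirds_lt : (2 / 3 : ℝ) ^ (4 / 3 : ℝ) < 0.583 := by
  have h0 : 0 ≤ (2 / 3 : ℝ) ^ (4 / 3 : ℝ) := Real.rpow_nonneg (by norm_num) _
  have h3 : ((2 / 3 : ℝ) ^ (4 / 3 : ℝ)) ^ 3 = (2 / 3 : ℝ) ^ 4 := by
    rw [rpow_rpow_natCast (by norm_num) (4 / 3) 3,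
      show (4 / 3 : ℝ) * (3 : ℕ) = ((4 : ℕ) : ℝ) by norm_num, Real.rpow_natCast]
  have hlt : ((2 / 3 : ℝ) ^ (4 / 3 : ℝ)) ^ 3 < (0.583 : ℝ) ^ 3 := by rw [h3]; norm_num
  exact lt_of_pow_lt_pow_left₀ 3 (by norm_num) hlt

/-- `κ_S < 0.583 · κ_A`. [folklore] -/
theorem palinstrophyLadderConstStrain_lt :
    palinstrophyLadderConstStrain < 0.583 * palinstrophyLadderConst := by
  rw [palinstrophyLadderConstStrain_eq]
  have hκ : 0 < palinstrophyLadderConst := by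
    unfold palinstrophyLadderConst; positivity
  exact mul_lt_mul_of_pos_right two_thirds_rpow_four_thirds_lt hκ


end Summit.NavierStokesRegularity.FunctionalMining

end
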